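import Summits.CriticalPhenomena.PercolationContinuityZ3.Theorems.Transplant.FKDoubleFanOneSidedConeA
import HarnessLib

/-!
# Double fans `K₂ ∨ P_{m+1}`: the `a`-sided cone over the SEMIALGEBRAIC RELAXATION `Valid ∧ U_a ∧ U_b ∧ U_c` — one all-affine closure statement,
# quantified over an explicit class

Helper file (`--supports stmt-CriticalPhenomena-4575`), FK sub-lane `prim-bschramm-fk-3` (gen 37); builds on p205010 (kernel theorem, internal
audit signed; external expert review pending).  No named facts, no sorries; standard axioms.  Memo `bschramm/prim-bschramm-fk-3/FAR-CROSS-XII.md` §1.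

`…OneSidedConeA` shows that ONE closure statement `HypBa` about the bi-dual of the `a`-images `imgA q F w`, `F, w ∈ InKE q`, gives the far
cross-apex theorem for all middles.  `InKE` is an inductively generated set with no explicit description; here it is replaced throughout by the
EXPLICIT semialgebraic class **`InS q`** `:= Valid q Z ∧ (U_a)(Z) ∧ (U_b)(Z) ∧ (U_c)(Z)` (the eight `Valid` inequalities and the three
square-root-free `U`-conditions of `…UCondRim`).  `InS` contains `InKE` (**`InKE.inS`**), is closed under letters and rim steps (**`InS.conv`**,
**`InS.rimStep`**), and LEMMA′ holds on it (`fanPhi_nonneg_validU`), so every `a`-image `imgA q F w` with `F, w ∈ InS q` still pairs `≥ 0`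
with every target (**`target_osDualS`**).  The bi-dual **`osConeS q`** of these images (dual **`OSDualS`**) is LARGER than `osConeA q`
(**`osConeA_subset_osConeS`**), contains the inputs, and is a letter cone as soon as
  **(CL_S)** `HypBaS q`: `opBC y (imgA q F w) ∈ osConeS q` for all `F, w ∈ InS q`, `y ∈ [0,1]`
(**`isLetterCone_osConeS`**); hence **`negCorr_spokes_cross_far_of_hypBaS`** (all middles, all distances, `0 < q ≤ 1`).  Both legs of (CL_S)
are affine along their fibres and range over a class cut out by finitely many polynomial inequalities, whose fibre endpoints (the `Λ`-floor and
the `U`-roof) lie in the class itself.  Numerically (memo §1, kit j266076/j266116/j266117: cutting planes whose oracle samples `InS × InS`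
directly) (CL_S) — and even the `a`-spoke/`b`-gadget statement — hold in every instance with margin, whereas with gadgets sampled from short
`InKE` derivations the same targets looked separated by `~10⁻³` (atom poverty, not non-membership).
[folklore]
-/

noncomputable section

namespace Summit.CriticalPhenomena.PercolationContinuityZ3.Theorems

namespace FK

namespace ThreeApex

/-! ### The explicit class `InS` -/

/-- The semialgebraic relaxation of `InKE q`: the `Valid` package and the three `U`-conditions. [folklore] -/
structure InS (q : ℝ) (Z : V5) : Prop where
  /-- the eight `Valid` inequalities -/
  valid : Valid q Z
  /-- `(U_a)` -/
  ua : UCond q Z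
  /-- `(U_b)` -/
  ub : UCond q (swapAB Z)
  /-- `(U_c)` -/
  uc : UCond q (swapAC Z)

/-- `InKE ⊆ InS` (`0 < q ≤ 1`). [folklore] -/
theorem InKE.inS {q : ℝ} (hq0 : 0 < q) (hq1 : q ≤ 1) {Z : V5} (h : InKE q Z) : InS q Z :=
  ⟨h.valid hq0.le hq1, (h.uCond_all hq0 hq1).1, (h.uCond_all hq0 hq1).2.1, (h.uCond_all hq0 hq1).2.2⟩

/-- `InS` is closed under rim steps. [folklore] -/
theorem InS.rimStep {q r : ℝ} (hq0 : 0 < q) (hq1 : q ≤ 1) (hr0 : 0 ≤ r) (hr1 : r ≤ 1) {Z : V5} (h : InS q Z) :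
    InS q (ThreeApex.rimStep q r Z) := by
  refine ⟨h.valid.rimStep hq0.le hq1 hr0 hr1, h.ua.rimStep hq0 hq1 hr0 hr1 h.valid.nonneg, ?_, ?_⟩
  · rw [swapAB_rimStep]; exact h.ub.rimStep hq0 hq1 hr0 hr1 h.valid.swapAB.nonneg
  · intro w₁ w₂ hw₁ hw₂
    rw [uForm_swapAC_rimStep]
    have hq' : 0 ≤ 1 - q := sub_nonneg.2 hq1
    have hr' : 0 ≤ 1 - r := sub_nonneg.2 hr1
    have := h.uc w₁ w₂ hw₁ hw₂
    positivity

/-- `InS` is closed under products. [folklore] -/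
theorem InS.conv {q : ℝ} (hq0 : 0 < q) (hq1 : q ≤ 1) {Y Z : V5} (hY : InS q Y) (hZ : InS q Z) : InS q (ThreeApex.conv Y Z) := by
  refine ⟨hY.valid.conv hq0.le hZ.valid, UCond.conv hq0 hq1 hY.valid hZ.valid hY.ua hZ.ua, ?_, ?_⟩
  · rw [swapAB_conv]; exact UCond.conv hq0 hq1 hY.valid.swapAB hZ.valid.swapAB hY.ub hZ.ub
  · rw [swapAC_conv]; exact UCond.conv hq0 hq1 hY.valid.swapAC hZ.valid.swapAC hY.uc hZ.uc

/-- Letters lie in `InS` (`0 < q ≤ 1`). [folklore] -/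
theorem IsLetter.inS {q : ℝ} (hq0 : 0 < q) (hq1 : q ≤ 1) {z : V5} (hz : IsLetter q z) : InS q z := by
  have h : InS q (ThreeApex.conv z delta0) := (InKE.step hz InKE.base).inS hq0 hq1
  have e : ThreeApex.conv z delta0 = z := by ext <;> simp [ThreeApex.conv, delta0, V5.total]
  rwa [e] at h

/-- `InS` is closed under letters. [folklore] -/
theorem InS.step {q : ℝ} (hq0 : 0 < q) (hq1 : q ≤ 1) {z Z : V5} (hz : IsLetter q z) (hZ : InS q Z) : InS q (ThreeApex.conv z Z) :=
  (hz.inS hq0 hq1).conv hq0 hq1 hZ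

/-! ### The dual and bi-dual over `InS` -/

/-- The dual of the `a`-images with gadget and rest in `InS q`. [folklore] -/
def OSDualS (q : ℝ) (γ : Biv) : Prop := ∀ F w : V5, InS q F → InS q w → 0 ≤ pairH q (imgA q F w) γ

/-- **The `a`-sided cone over the relaxation**: the bi-dual of `{imgA q F w : F, w ∈ InS q}`. [folklore] -/
def osConeS (q : ℝ) : Set Biv := {β | ∀ γ : Biv, OSDualS q γ → 0 ≤ pairH q β γ}

/-- `a`-images (over `InS`) lie in the cone. [folklore] -/
theorem imgA_mem_osConeS {q : ℝ} {F w : V5} (hF : InS q F) (hw : InS q w) : imgA q F w ∈ osConeS q :=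
  fun _ hγ => hγ F w hF hw

/-- **Inputs lie in the cone** (`u ∈ InKE q`, `0 < q ≤ 1`). [folklore] -/
theorem input_mem_osConeS {q : ℝ} (hq0 : 0 < q) (hq1 : q ≤ 1) {u : V5} (hu : InKE q u) :
    wedgeH (conv (edgeAC 0) u) (conv (edgeAC 1) u) ∈ osConeS q := by
  rw [← imgA_fanInit]; exact imgA_mem_osConeS ((fanInit_inKE q).inS hq0 hq1) (hu.inS hq0 hq1)

/-- The `InS`-dual is contained in the `InKE`-dual (`0 < q ≤ 1`). [folklore] -/
theorem OSDualS.osDualA {q : ℝ} (hq0 : 0 < q) (hq1 : q ≤ 1) {γ : Biv} (h : OSDualS q γ) : OSDualA q γ :=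
  fun F w hF hw => h F w (hF.inS hq0 hq1) (hw.inS hq0 hq1)

/-- **The relaxation cone is the larger bi-dual**: `osConeA q ⊆ osConeS q` (`0 < q ≤ 1`). [folklore] -/
theorem osConeA_subset_osConeS {q : ℝ} (hq0 : 0 < q) (hq1 : q ≤ 1) : osConeA q ⊆ osConeS q :=
  fun _ hβ γ hγ => hβ γ (hγ.osDualA hq0 hq1)

/-- **(CL_S)**: every `b`-spoke applied to every `a`-image over `InS` stays in the cone. [folklore] -/
def HypBaS (q : ℝ) : Prop := ∀ (F w : V5) (y : ℝ), InS q F → InS q w → 0 ≤ y → y ≤ 1 → opBC y (imgA q F w) ∈ osConeS q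

namespace OSDualS

variable {q : ℝ} {γ : Biv}

/-- The dual is stable under rim steps (`0 < q ≤ 1`). [folklore] -/
theorem rim (hq0 : 0 < q) (hq1 : q ≤ 1) (hγ : OSDualS q γ) {r : ℝ} (hr0 : 0 ≤ r) (hr1 : r ≤ 1) : OSDualS q (opE q r γ) :=
  fun F w hF hw => by
    rw [← pairH_opE, opE_imgA]; exact hγ _ _ (hF.rimStep hq0 hq1 hr0 hr1) hw

/-- The dual is stable under `a`-spokes (`0 < q ≤ 1`). [folklore] -/
theorem ac (hq0 : 0 < q) (hq1 : q ≤ 1) (hγ : OSDualS q γ) {x : ℝ} (hx0 : 0 ≤ x) (hx1 : x ≤ 1) : OSDualS q (opAC x γ) :=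
  fun F w hF hw => by
    rw [← pairH_opAC, opAC_imgA]; exact hγ _ _ (hF.step hq0 hq1 (IsLetter.bc hx0 hx1)) hw

/-- The dual is stable under `b`-spokes, given (CL_S). [folklore] -/
theorem bc (hγ : OSDualS q γ) (hB : HypBaS q) {y : ℝ} (hy0 : 0 ≤ y) (hy1 : y ≤ 1) : OSDualS q (opBC y γ) :=
  fun F w hF hw => by
    rw [← pairH_opBC]; exact hB F w y hF hw hy0 hy1 γ hγ

end OSDualS

/-- **Under (CL_S) the relaxation cone is a letter cone** (`0 < q ≤ 1`). [folklore] -/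
theorem isLetterCone_osConeS {q : ℝ} (hq0 : 0 < q) (hq1 : q ≤ 1) (hB : HypBaS q) : IsLetterCone q (osConeS q) where
  zero_mem := fun γ _ => le_of_eq (pairH_zero_left q γ).symm
  add_mem := fun β γ hβ hγ δ hδ => by rw [pairH_add_left]; exact add_nonneg (hβ δ hδ) (hγ δ hδ)
  smul_mem := fun a β ha hβ δ hδ => by rw [pairH_smul_left]; exact mul_nonneg ha (hβ δ hδ)
  rim := fun r β hr0 hr1 hβ γ hγ => by rw [pairH_opE]; exact hβ _ (hγ.rim hq0 hq1 hr0 hr1)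
  ac := fun x β hx0 hx1 hβ γ hγ => by rw [pairH_opAC]; exact hβ _ (hγ.ac hq0 hq1 hx0 hx1)
  bc := fun y β hy0 hy1 hβ γ hγ => by rw [pairH_opBC]; exact hβ _ (hγ.bc hB hy0 hy1)

/-- **Every target lies in the `InS`-dual** (`0 < q < 1`, `s ∈ InKE q`): LEMMA′ on the relaxation (`fanPhi_nonneg_validU`). [folklore] -/
theorem target_osDualS {q : ℝ} (hq0 : 0 < q) (hq1 : q < 1) {s : V5} (hs : InKE q s) :
    OSDualS q (wedgeH (conv s (edgeBC 0)) (conv s (edgeBC 1))) := by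
  intro F w hF hw
  have hq2 : (q ^ 2 : ℝ) ≠ 0 := pow_ne_zero 2 hq0.ne'
  rw [mul_left_cancel₀ hq2 (pairH_imgA_target q F w s)]
  have hsV := hs.valid hq0.le hq1.le
  exact fanPhi_nonneg_validU hq0 hq1 hF.valid.nonneg hF.uc hw.valid.nonneg hw.ub hsV.nonneg (hs.uCond hq0 hq1.le)

/-- The relaxation cone pairs non-negatively with every target (`0 < q < 1`). [folklore] -/
theorem pairH_osConeS_target {q : ℝ} (hq0 : 0 < q) (hq1 : q < 1) {s : V5} (hs : InKE q s) :
    ∀ β, β ∈ osConeS q → 0 ≤ pairH q β (wedgeH (conv s (edgeBC 0)) (conv s (edgeBC 1))) :=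
  fun _ hβ => hβ _ (target_osDualS hq0 hq1 hs)

/-! ### The reduction: (CL_S) ⟹ the far cross-apex pair for every middle -/

/-- **(CL_S) ⟹ THE ALGEBRA-LEVEL FAR THEOREM** (`0 < q ≤ 1`; at `q = 1` the difference vanishes identically). [folklore] -/
theorem rayleigh_crossFar_of_hypBaS {q : ℝ} (hq0 : 0 < q) (hq1 : q ≤ 1) (hB : HypBaS q) :
    ∀ (mids : List (ℝ × ℝ × ℝ)), UnitBlocks mids → ∀ rd : ℝ, 0 ≤ rd → rd ≤ 1 → ∀ u s : V5, InKE q u → InKE q s →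
      0 ≤ crossFarZ q mids rd u s 1 0 * crossFarZ q mids rd u s 0 1 - crossFarZ q mids rd u s 1 1 * crossFarZ q mids rd u s 0 0 := by
  intro mids hm rd hrd0 hrd1 u s hu hs
  rcases eq_or_lt_of_le hq1 with h1 | h1
  · subst h1
    exact rayleigh_crossFar_of_hypBa one_pos le_rfl hypBa_one mids hm rd hrd0 hrd1 u s hu hs
  · have key := rayleigh_crossFar_of_isLetterCone (isLetterCone_osConeS hq0 hq1 hB) hm hrd0 hrd1 (input_mem_osConeS hq0 hq1 hu)
      (pairH_osConeS_target hq0 h1 hs)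
    simp only [crossFarZ]
    linarith [key]

open MeasureTheory Literature.Probability.LatticeModels Literature.Probability.Percolation
open scoped Classical

variable {V : Type*} [Fintype V]

section Setting

variable {a b : V} {c : ℕ → V} {m : ℕ}
variable (hab : a ≠ b) (hinj : ∀ j k, j ≤ m → k ≤ m → c j = c k → j = k) (hca : ∀ j, j ≤ m → c j ≠ a) (hcb : ∀ j, j ≤ m → c j ≠ b)
include hab hinj hca hcb

/-- **(CL_S) ⟹ NEGATIVE CORRELATION OF EVERY CROSS-APEX PAIR AT EVERY DISTANCE.**  If the single closure statement `HypBaS q` — quantified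
over the explicit class `InS q` — holds at `q ∈ (0,1]`, then for every weighted double fan (`card V = m + 3`, weights supported on the double-fan
pairs) and all `j < k ≤ m`: `φ(J_{a c_j} ∩ J_{b c_k}) ≤ φ(J_{a c_j})·φ(J_{b c_k})` — no restriction on the middle. [folklore] -/
theorem negCorr_spokes_cross_far_of_hypBaS (hcard : Fintype.card V = m + 3) {q : ℝ} (hq0 : 0 < q) (hq1 : q ≤ 1)
    (w : Sym2 V → unitInterval) (hsupp : ∀ e, e ∉ dfPairs a b c m → w e = 0) (hB : HypBaS q) {j k : ℕ} (hjk : j < k) (hk : k ≤ m) :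
    (rcMeasureW w q ∅).real ({ω : BondConfig V | s(a, c j) ∈ ω} ∩ {ω | s(b, c k) ∈ ω}) ≤
      (rcMeasureW w q ∅).real {ω : BondConfig V | s(a, c j) ∈ ω} * (rcMeasureW w q ∅).real {ω : BondConfig V | s(b, c k) ∈ ω} :=
  negCorr_spokes_cross_far_of_inKE hab hinj hca hcb hcard hq0 w hsupp (rayleigh_crossFar_of_hypBaS hq0 hq1 hB) hjk hk

end Setting

end ThreeApex

end FK

end Summit.CriticalPhenomena.PercolationContinuityZ3.Theorems
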